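import Summits.QuantumFields.BalabanUV.T4Continuum.Support.NE7HintOfLocalChartGenericWide
import Summits.QuantumFields.BalabanUV.T4Continuum.Support.NE7CubeChartTorus
import HarnessLib

/-!
# NE7HintOfCubeChartGeneric — PORT MAP P2, FILE 2: (8)∃ FROM THE PRINTED FIRST-ORDER CUBE CHART OF [B11] Thm 1 (9) FOR EVERY UNITARY GAUGE GROUP `U(n)` AND EVERY BLOCK SIZE
# `L ≥ 2` ON T⁴ — `NE7HintOfCubeChartSU2.chart_of_cubeChart_SU2` (torus plumbing of THE CHART) and `NE7HintOfCubeChartSU2DecSlice.hint_of_cubeChart_SU2` (F298, `card n = 2`, `L = 2`)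
# RE-ISSUED GENERICALLY over P2.1 `NE7HintOfLocalChartGenericWide.hint_of_localChart_generic_wide` and the generic torus plumbing `NE7CubeChartTorus.exists_periodic_chart_of_cubeChart`

Cell `pub-balaban`, rung (B)+1 sub-cell t4, lineage `b2b-balaban-t4-ne7-p1`, generation 109 (CRUX PROVER NE7 #1 = OWNER of BINDER row NE7).  Memo
`t4/b2b-balaban-t4-ne7-p1-g109/ROAD-G109.md` §3 (PORT MAP item P2.2).  THE ONE NON-VERBATIM POINT: at block size `L` the neighbourhood radius is `nbRad 4 L = 10L` (record: `nbRad 4 2 = 20`),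
so the cover factor making the chart ball (radius `(nbRad 4 L + 2ℓ + 11)·L^{k+1}` plus a collar `2·L^{k+1} + 4`) a proper sub-box of the cover torus is `Kc = 4ℓ + 20L + 24` (record: `4ℓ + 64`).
WHAT ([folklore]; 0 def, 0 sorry).  **`chart_of_cubeChart`** (`2 ≤ L`, `4ℓ + 20L + 24 ≤ Kc`): the cube chart (CUBE) ⟹ the periodic chart THE CHART of P2.1, constants `(c₀, c₀ + c₁)`;
**`hint_of_cubeChart_generic`**: F298 TOKEN FOR TOKEN under the recipe (`2 ↦ L`, `8·CPLine…+1 ↦ C_E`, `4ℓ+64 ↦ 4ℓ+20L+24`, `hn ↦` nothing).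
HONEST FRAMING (page 1): composition of landed kernel theorems; constants existential; nothing of Bałaban's asserted; (CUBE), `hdecomp` and the strict line REMAIN HYPOTHESES (their generic
discharge = PORT MAP P2.3–P2.6); NE7 NOT proved; spine 0∕9; finite T⁴ rung (B)+1 — NOT infinite volume, NOT mass gap, NOT BetaPertH, NOT Clay (continuum YM on T⁴ ⇐ BetaPertH ∧ nine spine
estimates).
-/

set_option autoImplicit false

open scoped BigOperators Matrix Matrix.Norms.L2Operator Topology
open NormedSpace Finset Set Filter

namespace Summit.QuantumFields.BalabanUV.T4Continuum.NE7HintOfCubeChartGeneric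

open Literature.MathematicalPhysics.QuantumFieldTheory.Balaban1983to89
open B7Prop1Explicit B7Prop2Explicit MatrixLog UnitaryModel
open B4TorusKernel.MultiPeriod (torusSupNorm)
open T4AveragingDeficitWall (Ad IsUnitaryCfg IsSkewDir SmallField vary curl curlSq dirSq dirL1)
open T4AveragingDeficitWallBoundary (IsPeriodicCfg periodBox)
open AveragingDeficitPeriodicCounting (IsPeriodicDir)
open AveragingDeficitMultiLevelPrep (LevelSmall tower TangentIter)
open BlockAverageVaryHolo (nbRad)
open MinimalActionLevels (perWin)
open MinimalActionSandwich (IsMinimiser admissible)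
open MinimalActionRate (sfClass)
open NE3HessForm (dAction)
open NE3EnergyShapes (IsUnitarySite)
open BlockAveragePushDirSplit (flat)
open NE7HintOfLocalChartGenericWide (hint_of_localChart_generic_wide)
open NE3EnergyWeightedShapes (energyNormW)
open NE7MeanZeroGaugeSliceW (energyBlockLandauW)
open NE7CubeChartTorus (exists_periodic_chart_of_cubeChart)

noncomputable section

variable {n : Type*} [Fintype n] [DecidableEq n]

/-! ## §1 Torus plumbing of the cube chart at block size `L` -/

/-- **THE CHART of P2.1 from (CUBE), any `L ≥ 2`** (`nbRad 4 L = 10L`, cover factor `Kc ≥ 4ℓ + 20L + 24`). [folklore] -/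
theorem chart_of_cubeChart (ℓ : ℕ) {L N : ℕ} [NeZero N] (hL : 2 ≤ L) (hN : 1 ≤ N) {Kc : ℕ} (hKc : 4 * ℓ + 20 * L + 24 ≤ Kc) {ε β c₀ c₁ : ℝ} (hε0 : 0 ≤ ε)
    (hβ0 : 0 ≤ β) (hc₀ : 0 ≤ c₀) (hc₁ : 0 ≤ c₁)
    (hcube : (∀ D : Site 4 → Fin 4 → (Matrix n n ℂ)ˣ, IsUnitaryCfg D → IsPeriodicCfg D ((N * Kc) : ℤ) → SmallField D (4 * (Real.exp β - 1)) →
      ∀ (k : ℕ), ∀ U ∈ admissible (sfClass 4 L (N * Kc) ε) L (k + 1) D,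
      (∀ φ : Site 4 → Fin 4 → Matrix n n ℂ, IsSkewDir φ → IsPeriodicDir φ (((N * Kc) * L ^ (k + 1) : ℕ) : ℤ) → TangentIter L k U φ →
        dAction U φ (perWin 4 ((N * Kc) * L ^ (k + 1))) = 0) →
      ∀ r : ℝ, 0 ≤ r → r ≤ (1 / (L : ℝ) ^ 2 * ε) → SmallField U (r / ((L : ℝ) ^ (k + 1)) ^ 2) →
      ∀ z : Site 4, ∃ (u₀ : Site 4 → (Matrix n n ℂ)ˣ) (A₀ : Site 4 → Fin 4 → Matrix n n ℂ), IsUnitarySite u₀ ∧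
        (∀ (p : Site 4) (μ : Fin 4), (∀ i, |p i - z i| ≤ (((nbRad 4 L + 2 * ℓ + 11) * L ^ (k + 1) : ℕ) : ℤ)) → gaugeAct u₀ U p μ = expUnit (A₀ p μ)) ∧
        (∀ (p : Site 4) (μ : Fin 4), (∀ i, |p i - z i| ≤ (((nbRad 4 L + 2 * ℓ + 11) * L ^ (k + 1) : ℕ) : ℤ)) → A₀ p μ ∈ skewAdjoint (Matrix n n ℂ)) ∧
        (∀ (p : Site 4) (μ : Fin 4), (∀ i, |p i - z i| ≤ (((nbRad 4 L + 2 * ℓ + 11) * L ^ (k + 1) : ℕ) : ℤ)) →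
          ‖A₀ p μ‖ ≤ c₀ * (r + 4 * (Real.exp β - 1) + ε) / (L : ℝ) ^ (k + 1)) ∧
        (∀ (p : Site 4) (μ τ : Fin 4), (∀ i, |p i - z i| ≤ (((nbRad 4 L + 2 * ℓ + 11) * L ^ (k + 1) : ℕ) : ℤ)) →
          (∀ i, |(p + e τ) i - z i| ≤ (((nbRad 4 L + 2 * ℓ + 11) * L ^ (k + 1) : ℕ) : ℤ)) →
          ‖A₀ (p + e τ) μ - A₀ p μ‖ ≤ c₁ * (r + 4 * (Real.exp β - 1) + ε) / ((L : ℝ) ^ (k + 1)) ^ 2))) :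
    (∀ D : Site 4 → Fin 4 → (Matrix n n ℂ)ˣ, IsUnitaryCfg D → IsPeriodicCfg D ((N * Kc) : ℤ) → SmallField D (4 * (Real.exp β - 1)) →
      ∀ (k : ℕ), ∀ U ∈ admissible (sfClass 4 L (N * Kc) ε) L (k + 1) D,
      (∀ φ : Site 4 → Fin 4 → Matrix n n ℂ, IsSkewDir φ → IsPeriodicDir φ (((N * Kc) * L ^ (k + 1) : ℕ) : ℤ) → TangentIter L k U φ →
        dAction U φ (perWin 4 ((N * Kc) * L ^ (k + 1))) = 0) →
      ∀ r : ℝ, 0 ≤ r → r ≤ (1 / (L : ℝ) ^ 2 * ε) → SmallField U (r / ((L : ℝ) ^ (k + 1)) ^ 2) →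
      ∀ z : Site 4, ∃ (u : Site 4 → (Matrix n n ℂ)ˣ) (At : Site 4 → Fin 4 → Matrix n n ℂ) (a₀ a₁ : ℝ),
        IsUnitarySite u ∧ (∀ (y : Site 4) (i : Fin 4), u (y + (((N * Kc) * L ^ (k + 1) : ℕ) : ℤ) • e i) = u y) ∧
        IsSkewDir At ∧ IsPeriodicDir At (((N * Kc) * L ^ (k + 1) : ℕ) : ℤ) ∧ 0 ≤ a₀ ∧ 0 ≤ a₁ ∧
        (∀ (y : Site 4) (κ : Fin 4), ‖At y κ‖ ≤ a₀) ∧ (∀ (y : Site 4) (κ τ : Fin 4), ‖At (y + e τ) κ - At y κ‖ ≤ a₁) ∧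
        (L : ℝ) ^ (k + 1) * a₀ ≤ c₀ * (r + 4 * (Real.exp β - 1) + ε) ∧ ((L : ℝ) ^ (k + 1)) ^ 2 * a₁ ≤ (c₀ + c₁) * (r + 4 * (Real.exp β - 1) + ε) ∧
        (∀ (y : Site 4) (κ : Fin 4),
          torusSupNorm (fun _ : Fin 4 => L ^ (k + 1) * (N * Kc)) (y - z) ≤ (((nbRad 4 L + 2 * ℓ + 10) * L ^ (k + 1) : ℕ) : ℝ) →
            gaugeAct u U y κ = vary (flat (d := 4) (n := n)) At 1 y κ)) := by
  intro D hDu hDP hDs k U hU hcrit r hr0 hr hUr z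
  obtain ⟨u₀, A₀, hu₀, hUA, hskew, hA0, hA1⟩ := hcube D hDu hDP hDs k U hU hcrit r hr0 hr hUr z
  clear hcube
  -- the block size `M = L^{k+1}` (generalised), the radii, the period `N·Kc·M`
  have hM2 : 2 ≤ L ^ (k + 1) :=
    calc 2 ≤ L := hL
      _ = L ^ 1 := (pow_one L).symm
      _ ≤ L ^ (k + 1) := Nat.pow_le_pow_right (by omega) (by omega)
  have hMr' : (L : ℝ) ^ (k + 1) = ((L ^ (k + 1) : ℕ) : ℝ) := by rw [Nat.cast_pow]
  rw [hMr'] at hA0 hA1 ⊢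
  generalize hMdef : L ^ (k + 1) = M at *
  have hM1 : 1 ≤ M := by omega
  have hMr : (2 : ℝ) ≤ (M : ℝ) := by exact_mod_cast hM2
  have hM0r : (0 : ℝ) < (M : ℝ) := by linarith
  -- the class data of `U`
  have hUP : IsPeriodicCfg U ((N * Kc * M : ℕ) : ℤ) := by rw [← hMdef]; exact hU.1.2.1
  -- the datum `t`
  have hβ' : 0 ≤ 4 * (Real.exp β - 1) := by nlinarith [Real.add_one_le_exp β]
  have hT0 : 0 ≤ r + 4 * (Real.exp β - 1) + ε := by linarith
  have hb₀ : 0 ≤ c₀ * (r + 4 * (Real.exp β - 1) + ε) / (M : ℝ) := by positivity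
  have hb₁ : 0 ≤ c₁ * (r + 4 * (Real.exp β - 1) + ε) / (M : ℝ) ^ 2 := by positivity
  -- the geometric conditions of F297 (`nbRad 4 L = 10L`)
  have hnb : nbRad 4 L = 10 * L := by unfold BlockAverageVaryHolo.nbRad; ring
  have hMwR : M ≤ (nbRad 4 L + 2 * ℓ + 11) * M := by rw [hnb]; nlinarith
  have hPR : 2 * ((nbRad 4 L + 2 * ℓ + 11) * M) + 4 ≤ N * Kc * M := by
    rw [hnb]
    have h1 : 4 * ℓ + 20 * L + 24 ≤ N * Kc := hKc.trans (Nat.le_mul_of_pos_left _ (by omega))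
    have h2 : (4 * ℓ + 20 * L + 24) * M ≤ N * Kc * M := Nat.mul_le_mul_right _ h1
    nlinarith
  -- F297
  obtain ⟨u, At, huU, huP, hAs, hAP, hsup, hgr, hagree⟩ :=
    exists_periodic_chart_of_cubeChart (d := 3) (n := n) hUP z ((nbRad 4 L + 2 * ℓ + 11) * M) M hM1 hMwR hPR hu₀ hb₀ hb₁ hUA hskew hA0 hA1
  refine ⟨u, At, _, _, huU, huP, hAs, hAP, hb₀, ?_, hsup, hgr, ?_, ?_, ?_⟩
  · positivity
  · -- `M·a₀ ≤ c₀·t`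
    rw [show (M : ℝ) * (c₀ * (r + 4 * (Real.exp β - 1) + ε) / (M : ℝ)) = c₀ * (r + 4 * (Real.exp β - 1) + ε) by field_simp]
  · -- `M²·a₁ ≤ (c₀ + c₁)·t`
    rw [show (M : ℝ) ^ 2 * (c₁ * (r + 4 * (Real.exp β - 1) + ε) / (M : ℝ) ^ 2 + c₀ * (r + 4 * (Real.exp β - 1) + ε) / (M : ℝ) / (M : ℝ))
      = (c₀ + c₁) * (r + 4 * (Real.exp β - 1) + ε) by field_simp; ring]
  · -- agreement on the ball of radius `(nbRad 4 L + 2ℓ + 10)·M`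
    intro y κ hy
    apply hagree y κ
    have e2 : (nbRad 4 L + 2 * ℓ + 11) * M - M = (nbRad 4 L + 2 * ℓ + 10) * M := by
      apply Nat.sub_eq_of_eq_add
      ring
    rw [e2]
    convert hy using 2
    funext i
    ring


/-! ## §2 (8)∃ from the printed cube chart, every `U(n)`, every `L ≥ 2` -/

set_option maxHeartbeats 800000 in
/-- **P2.2 — F298 GENERIC: (8)∃ FROM THE PRINTED FIRST-ORDER CHART OF [B11] Thm 1 (9) ON CUBES, every `U(n)`, every `L ≥ 2`, on T⁴** (statement in the file header). [folklore] -/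
theorem hint_of_cubeChart_generic [Nonempty n] {L : ℕ} (hL : 2 ≤ L) {A : ℝ} (hA : 0 ≤ A) (p : ℕ) :
    ∃ CE : ℝ, 0 < CE ∧ ∃ ℓ : ℕ, 1 ≤ ℓ ∧ ∃ ε₀ : ℝ, 0 < ε₀ ∧ ∀ ε : ℝ, 0 < ε → ε ≤ ε₀ → ∃ β₀ : ℝ, 0 < β₀ ∧ ∀ β : ℝ, 0 < β → β ≤ β₀ →
    ∀ (N : ℕ) [NeZero N] (αh νh κh c₀ c₁ : ℝ), 1 ≤ N →
    -- the k-free ceilings `(α̂, ν̂, κ̂)` of the honest per-pair binder and ONE k-free strict line (F327)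
    2 * κh < ((((1 / 2 - νh ^ 2) / (2 * (1 + CE)) - νh ^ 2) / 2 - 576 * ((4 : ℕ) : ℝ) * (αh ^ 2 * Real.exp (2 * αh))) / (Fintype.card n : ℝ) - 28 * ((4 : ℕ) : ℝ) * (ε + 7 * αh ^ 2)) →
    0 ≤ c₀ → c₀ ≤ A * ((ℓ : ℝ) + 1) ^ p → 0 ≤ c₁ → c₁ ≤ A * ((ℓ : ℝ) + 1) ^ p →
    -- (CUBE): the printed first-order chart of [B11] Thm 1 (9) about every point, on the `(4ℓ+64)`-fold cover
    (∀ D : Site 4 → Fin 4 → (Matrix n n ℂ)ˣ, IsUnitaryCfg D → IsPeriodicCfg D ((N * (4 * ℓ + 20 * L + 24)) : ℤ) → SmallField D (4 * (Real.exp β - 1)) →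
      ∀ (k : ℕ), ∀ U ∈ admissible (sfClass 4 L (N * (4 * ℓ + 20 * L + 24)) ε) L (k + 1) D,
      (∀ φ : Site 4 → Fin 4 → Matrix n n ℂ, IsSkewDir φ → IsPeriodicDir φ (((N * (4 * ℓ + 20 * L + 24)) * L ^ (k + 1) : ℕ) : ℤ) → TangentIter L k U φ →
        dAction U φ (perWin 4 ((N * (4 * ℓ + 20 * L + 24)) * L ^ (k + 1))) = 0) →
      ∀ r : ℝ, 0 ≤ r → r ≤ (1 / (L : ℝ) ^ 2 * ε) → SmallField U (r / ((L : ℝ) ^ (k + 1)) ^ 2) →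
      ∀ z : Site 4, ∃ (u₀ : Site 4 → (Matrix n n ℂ)ˣ) (A₀ : Site 4 → Fin 4 → Matrix n n ℂ), IsUnitarySite u₀ ∧
        (∀ (p : Site 4) (μ : Fin 4), (∀ i, |p i - z i| ≤ (((nbRad 4 L + 2 * ℓ + 11) * L ^ (k + 1) : ℕ) : ℤ)) → gaugeAct u₀ U p μ = expUnit (A₀ p μ)) ∧
        (∀ (p : Site 4) (μ : Fin 4), (∀ i, |p i - z i| ≤ (((nbRad 4 L + 2 * ℓ + 11) * L ^ (k + 1) : ℕ) : ℤ)) → A₀ p μ ∈ skewAdjoint (Matrix n n ℂ)) ∧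
        (∀ (p : Site 4) (μ : Fin 4), (∀ i, |p i - z i| ≤ (((nbRad 4 L + 2 * ℓ + 11) * L ^ (k + 1) : ℕ) : ℤ)) →
          ‖A₀ p μ‖ ≤ c₀ * (r + 4 * (Real.exp β - 1) + ε) / (L : ℝ) ^ (k + 1)) ∧
        (∀ (p : Site 4) (μ τ : Fin 4), (∀ i, |p i - z i| ≤ (((nbRad 4 L + 2 * ℓ + 11) * L ^ (k + 1) : ℕ) : ℤ)) →
          (∀ i, |(p + e τ) i - z i| ≤ (((nbRad 4 L + 2 * ℓ + 11) * L ^ (k + 1) : ℕ) : ℤ)) →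
          ‖A₀ (p + e τ) μ - A₀ p μ‖ ≤ c₁ * (r + 4 * (Real.exp β - 1) + ε) / ((L : ℝ) ^ (k + 1)) ^ 2)) →
    -- THE HONEST PER-PAIR BINDER `hdecomp` on the data class (F327's)
    (∀ D : Site 4 → Fin 4 → (Matrix n n ℂ)ˣ, IsUnitaryCfg D → IsPeriodicCfg D (N : ℤ) → SmallField D (4 * (Real.exp β - 1)) → ∀ (k : ℕ), ∀ Us ∈ admissible (sfClass 4 L N ε) L (k + 1) D, SmallField Us ((1 / (L : ℝ) ^ 2 * ε / 2) / ((L : ℝ) ^ (k + 1)) ^ 2) → (∀ φ : Site 4 → Fin 4 → Matrix n n ℂ, IsSkewDir φ → IsPeriodicDir φ ((N * L ^ (k + 1) : ℕ) : ℤ) → TangentIter L k Us φ → dAction Us φ (perWin 4 (N * L ^ (k + 1))) = 0) → ∀ U' ∈ admissible (sfClass 4 L N ε) L (k + 1) D, 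
      ∃ (u : Site 4 → (Matrix n n ℂ)ˣ) (X XT XN : Site 4 → Fin 4 → Matrix n n ℂ) (α ν κ : ℝ),
        IsUnitarySite u ∧ IsSkewDir X ∧ IsPeriodicDir X ((N * L ^ (k + 1) : ℕ) : ℤ) ∧ 0 ≤ α ∧ (∀ x μ, ‖X x μ‖ ≤ α) ∧
        gaugeAct u U' = vary Us X 1 ∧
        X = XT + XN ∧ XT ∈ energyBlockLandauW (d := 4) (n := n) L N (k + 1) Us ∧ IsSkewDir XN ∧ 0 ≤ ν ∧
        energyNormW L (k + 1) Us XN (periodBox (d := 4) (N * L ^ (k + 1)))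
          ≤ ν * energyNormW L (k + 1) Us X (periodBox (d := 4) (N * L ^ (k + 1))) ∧
        ε / ((L : ℝ) ^ (k + 1)) ^ 2 * (∑ p ∈ perWin 4 (N * L ^ (k + 1)), ‖curl Us XN p‖)
          ≤ κ * energyNormW L (k + 1) Us X (periodBox (d := 4) (N * L ^ (k + 1))) ^ 2 ∧
        α * (L : ℝ) ^ (k + 1) ≤ αh ∧ ν ≤ νh ∧ κ ≤ κh) →
    ∃ δV : ℝ, 0 < δV ∧
      ∀ V ∈ {V : Site 4 → Fin 4 → (Matrix n n ℂ)ˣ | IsUnitaryCfg V ∧ IsPeriodicCfg V (N : ℤ) ∧ SmallField V δV},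
      ∀ k : ℕ, ∃ U : Site 4 → Fin 4 → (Matrix n n ℂ)ˣ, IsMinimiser 4 (sfClass 4 L N ε) L N k V U ∧
        ∃ a : ℝ, 0 ≤ a ∧ a < ε / ((L : ℝ) ^ k) ^ 2 ∧ SmallField U a := by
  obtain ⟨CE, hCE, ℓ, hℓ1, ε₀, hε₀, H⟩ := hint_of_localChart_generic_wide (n := n) hL (A := 2 * A) (by positivity) p
  refine ⟨CE, hCE, ℓ, hℓ1, ε₀, hε₀, fun ε hε hεle => ?_⟩
  obtain ⟨β₀, hβ₀, H2⟩ := H ε hε hεle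
  refine ⟨β₀, hβ₀, ?_⟩
  intro β hβ hβle N _ αh νh κh c₀ c₁ hN hline hc₀ hc₀b hc₁ hc₁b hcube hdecomp
  have hpow : 0 ≤ A * ((ℓ : ℝ) + 1) ^ p := by positivity
  have hC₀b : c₀ ≤ 2 * A * ((ℓ : ℝ) + 1) ^ p := by linarith
  have hC₁ : 0 ≤ c₀ + c₁ := by positivity
  have hC₁b : c₀ + c₁ ≤ 2 * A * ((ℓ : ℝ) + 1) ^ p := by linarith
  have hchart := chart_of_cubeChart (n := n) ℓ hL hN (Kc := 4 * ℓ + 20 * L + 24) le_rfl hε.le hβ.le hc₀ hc₁ hcube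
  exact H2 β hβ hβle N (4 * ℓ + 20 * L + 24) c₀ (c₀ + c₁) αh νh κh hN (by omega)
    hline hc₀ hC₀b hC₁ hC₁b hchart hdecomp

end

end Summit.QuantumFields.BalabanUV.T4Continuum.NE7HintOfCubeChartGeneric
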